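import Literature.Barriers.PneNP.TSPExtensionComplexity
import Literature.Computability.Complexity.Circuit
import Mathlib.Analysis.LocallyConvex.Separation
import Mathlib.Analysis.LocallyConvex.WithSeminorms
import Mathlib.Analysis.Convex.Jensen
import Mathlib.Analysis.Convex.Topology
import Mathlib.LinearAlgebra.Pi
import Mathlib.LinearAlgebra.Matrix.ToLin
import HarnessLib

/-!
# Barrier catalogue `PneNP`: which "polynomial-size LPs for the TSP" the extension-complexity
barrier covers (D-0021 barrier audit of `TSPExtensionComplexity`, 2026-08-14)

Outcome of the refuter's audit of `Literature.Barriers.PneNP.TSPExtensionComplexity`: the formal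
content of that entry (FMPTW Thm. 12 as the named fact `TSPExtensionComplexity`, Rothvoß's bound,
the proved no-go readings `not_poly` / `no_polysize_ef`) is CONFIRMED — faithful to print and not
refutable; its `technique_class:` prose (`polynomial-size-lp, …, lp-for-tsp, compact-lp-
formulations`) is NARROWED to what the printed theorems quantify over, and its `evasions_known:`
list is corrected in the other direction (three listed "evasions" are closed in print). This file
is the formal counterpart.

1. **What an LP must do to fall under the barrier.** FMPTW's own notion is "an LP over this set
   of [natural edge] variables plus extra variables that returns the correct objective function
   value for all instances ..., that is, for all choices of weights" (§1.1, PDF p. 3). We define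
   it (`LPSolvesTSPOn n W r`: a size-`r` slack-form system over the edge variables of `K_n` whose
   projection contains `TSP(n)` and is an exact optimizer for every weight vector in the class
   `W`) and PROVE that for `W =` all nonnegative weights (genuine TSP instances) it is equivalent
   to being an extended formulation of `TSP(n)` of the same size (`lpSolvesTSPOn_nonneg_iff`: one
   added equation `Σ_e x_e = n` and a separating-hyperplane argument). Hence the barrier fact,
   restated on FMPTW's class (`TSPExtensionComplexityNarrow`), is EQUIVALENT to
   `TSPExtensionComplexity` (`tspExtensionComplexityNarrow_iff`), and "no polynomial-size LP solves
   the TSP" is a theorem from the fact (`TSPExtensionComplexity.no_polysize_lp_solves`).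
2. **Closed in print, not evasions** (prose; the cited theorems are not restated here):
   restricting the weights to `{0,1,2}` (maximum-weight Hamiltonian cycle, uniform on `K_n`) and
   re-encoding the solutions by ANY linear encoding with affine objective read-out still costs
   `2^{Ω(n)}` (Braun–Pokutta–Zink, LP formulation complexity of a PROBLEM, Def. 2.5 and
   Example 4.7); semidefinite EFs of `TSP(n)` cost `2^{Ω(n^{1/13})}` (Lee–Raghavendra–Steurer
   Cor. 1.2); mixed-integer EFs of size `2^{γ n}` need `Ω(n / log n)` integer variables
   (Cevallos–Weltge–Zenklusen Cor. 25). The published "non-applicability" claims of LP-based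
   `P = NP` attempts in non-natural variables (Diaby et al., arXiv:1610.00353 App. A) are void for
   this reason, and the LPs themselves have printed counterexamples (Hofman 2006, 2025).
3. **What is NOT covered, and cannot be short of the summit** (Yannakakis 1991, p. 445): "the
   `P = NP?` question is equivalent to a weaker requirement of the LP (than that expressing the
   TSP polytope)": an **HC polytope** — a polytope over the edge variables containing the
   characteristic vectors of the Hamiltonian graphs and excluding those of the non-Hamiltonian
   ones (`IsHCPolytope`, `HasHCPolytopeOfSize`) — exists in polynomial size for every `n` iff
   `NP ⊆ P/poly` (Yannakakis' Proposition, via Valiant's gate-by-gate LP; its `→` half at fixed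
   `n` is PROVED in the companion file `TSPExtensionComplexityHCPolytopeCircuit.lean`,
   `hasHCPolytopeOfSize_of_circuit`: size `5 s` from a circuit of size `s`). Every LP solving the TSP on
   `0/1` weights yields an HC polytope of essentially the same size (PROVED:
   `LPSolvesTSPOn.hasHCPolytopeOfSize`), but not conversely: an HC polytope is a DECISION object
   (membership of `0/1` points), and a size lower bound for it is a circuit lower bound for
   HAMILTONIAN CYCLE. So "a polynomial-size LP over the natural variables" is barred only as an
   OPTIMIZER containing the tours; as a decision device it is the routes' `¬X` item itself.

## Sources (locators verified with `lit read`)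

* [FioriniEtAl2015] arXiv:1111.0837: §1–1.1 (PDF p. 3: Swart; "solves"; slack form w.l.o.g.),
  Thm. 12 (PDF p. 11), §6 (PDF p. 16: pairs sandwiched between `CUT(n)` and `Q(n)`).
* [Rothvoss2017] arXiv:1311.2369: Thm. 1, Cor. 2 (PDF p. 4), odd-cut slack block (PDF p. 5).
* [Yannakakis1991] JCSS 43 (print pp. 441–466; held as the STOC text with JCSS pagination):
  p. 442 ("expresses"), p. 445 (LP is P-complete [DLR, V]; HC polytopes; Proposition and its
  proof by gate inequalities), p. 454 (Thm. 2: the `6n`-node graph whose tours are the perfect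
  matchings of `K_{2n}`).
* [BraunPokuttaZink2015] = arXiv:1410.8816: Def. 2.5 (PDF pp. 6–7), §3.1.1 (PDF p. 11),
  Example 4.7 (PDF pp. 15–16).
* [LeeRaghavendraSteurer2015] = arXiv:1411.6317: abstract (PDF p. 2), Cor. 1.2 (PDF p. 4).
* [CevallosWeltgeZenklusen2018] = arXiv:1712.02176: abstract (PDF p. 2), Cor. 25 (PDF p. 16).
* [Diaby2016] arXiv:1610.00353 (2016 version): abstract (PDF p. 1), App. A (PDF p. 14);
  [Hofman2006] arXiv:cs/0610125; [Hofman2025] Complexity 2025.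
-/

noncomputable section

namespace Literature.Barriers.PneNP

open Filter Matrix

/-- The natural coordinates of the TSP: the edges of `K_n` on `Fin n` (as a type).
[cite: FioriniEtAl2015, §1.1 (PDF p. 3: "a natural set of binary variables")] -/
abbrev Edges (n : ℕ) : Type := (⊤ : SimpleGraph (Fin n)).edgeSet

variable {n r : ℕ}

/-! ### Tours have `n` edges -/

/-- The edge set of a tour of `K_n` consists of edges of `K_n`. [folklore] -/
theorem IsTourEdgeSet.subset_edgeSet {F : Finset (Sym2 (Fin n))} (hF : IsTourEdgeSet F) :
    ∀ e ∈ F, e ∈ (⊤ : SimpleGraph (Fin n)).edgeSet := by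
  obtain ⟨u, p, _, rfl⟩ := hF
  intro e he
  exact p.edges_subset_edgeSet (List.mem_toFinset.1 he)

/-- A tour of `K_n` has exactly `n` edges (a Hamiltonian cycle has length `n`). [folklore] -/
theorem IsTourEdgeSet.card_eq {F : Finset (Sym2 (Fin n))} (hF : IsTourEdgeSet F) : F.card = n := by
  obtain ⟨u, p, hp, rfl⟩ := hF
  rw [List.toFinset_card_of_nodup hp.edges_nodup, SimpleGraph.Walk.length_edges, hp.length_eq,
    Fintype.card_fin]

/-- The characteristic vector of a tour sums to `n`: `Σ_e χ^F_e = |F| = n`. [folklore] -/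
theorem IsTourEdgeSet.sum_charVec {F : Finset (Sym2 (Fin n))} (hF : IsTourEdgeSet F) :
    ∑ e : Edges n, charVec F e = n := by
  classical
  have hsub := hF.subset_edgeSet
  simp only [charVec, Finset.sum_boole]
  have hfilter : (Finset.univ.filter fun e : Edges n => (e : Sym2 (Fin n)) ∈ F) =
      F.subtype (· ∈ (⊤ : SimpleGraph (Fin n)).edgeSet) := by
    ext e
    simp [Finset.mem_subtype]
  rw [hfilter, Finset.card_subtype, Finset.filter_true_of_mem hsub, hF.card_eq]

/-! ### LPs over the natural variables that solve the TSP on a class of weights -/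

/-- The class of nonnegative weight vectors on the edges of `K_n` (genuine TSP instances).
[cite: BraunPokuttaZink2015, Example 4.7 (PDF p. 15: "We consider only nonnegative weights as customary")] -/
def nonnegWeights (n : ℕ) : Set (Edges n → ℝ) := {c | ∀ e, 0 ≤ c e}

/-- The class of `0/1` weight vectors: minimising `Σ_{e ∉ H} x_e` over the tours decides whether
the graph `H` is Hamiltonian; equivalently the `{1,2}`-TSP. [cite: BraunPokuttaZink2015, §3.1.1 (PDF p. 11) and Example 4.7 (PDF p. 15)] -/
def zeroOneWeights (n : ℕ) : Set (Edges n → ℝ) := {c | ∀ e, c e = 0 ∨ c e = 1}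

/-- `0/1` weights are nonnegative. [folklore] -/
theorem zeroOneWeights_subset_nonnegWeights : zeroOneWeights n ⊆ nonnegWeights n := by
  intro c hc e
  rcases hc e with h | h <;> simp [h]

/-- **An LP over the natural variables that solves the TSP on the weight class `W`** (FMPTW
§1.1: "an LP over this set of variables plus extra variables that returns the correct objective
function value for all instances", here for the instances `c ∈ W`): a slack-form system with `r`
inequalities over the edge variables of `K_n` plus extra variables whose projection `Q` CONTAINS
the TSP polytope (every tour is feasible) and over which, for every `c ∈ W`, the minimum of
`c · x` is the length of an optimal tour — phrased without an infimum: every feasible `x` is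
matched by a tour `F` with `c · χ^F ≤ c · x`. For `W = nonnegWeights n` this is FMPTW's "solves"
(all weights; nonnegative ones suffice, `lpSolvesTSPOn_nonneg_iff`); for `W = zeroOneWeights n`
it is the exact LP for the Hamiltonian-cycle / `{1,2}`-TSP problem in the natural encoding
(Braun–Pokutta–Zink Def. 2.5 with `x^s = χ^s`). [cite: FioriniEtAl2015, §1.1 (PDF p. 3)] -/
def LPSolvesTSPOn (n : ℕ) (W : Set (Edges n → ℝ)) (r : ℕ) : Prop :=
  ∃ Q : ExtendedFormulation (Edges n) r, tspPolytope n ⊆ Q.projSet ∧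
    ∀ c ∈ W, ∀ x ∈ Q.projSet, ∃ F : Finset (Sym2 (Fin n)), IsTourEdgeSet F ∧ c ⬝ᵥ charVec F ≤ c ⬝ᵥ x

/-- Solving the TSP on a class of weights solves it on every subclass. [folklore] -/
theorem LPSolvesTSPOn.mono {W W' : Set (Edges n → ℝ)} (h : LPSolvesTSPOn n W r) (hW : W' ⊆ W) :
    LPSolvesTSPOn n W' r := by
  obtain ⟨Q, hsub, hex⟩ := h
  exact ⟨Q, hsub, fun c hc => hex c (hW hc)⟩

/-- **An extended formulation of `TSP(n)` solves the TSP on every weight class**: a linear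
functional on the convex hull of the tour vectors attains its minimum at a tour.
[cite: FioriniEtAl2015, §1.1 (PDF p. 3: "This minimum is attained at a vertex of the polytope")] -/
theorem HasEFOfSize.lpSolvesTSPOn (h : HasEFOfSize (tspPolytope n) r) (W : Set (Edges n → ℝ)) :
    LPSolvesTSPOn n W r := by
  classical
  obtain ⟨Q, hQ⟩ := h
  refine ⟨Q, by rw [hQ], fun c _ x hx => ?_⟩
  rw [hQ, tspPolytope_eq_convexHull_tourVectors] at hx
  obtain ⟨y, hy, hle⟩ :=
    ((dotProductBilin ℝ ℝ c).concaveOn convex_univ).exists_le_of_mem_convexHull (Set.subset_univ _) hx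
  simp only [tourVectors, Finset.coe_image, Finset.coe_filter, Finset.mem_univ, true_and,
    Set.mem_image, Set.mem_setOf_eq] at hy
  obtain ⟨F, hF, rfl⟩ := hy
  exact ⟨F, hF, hle⟩

/-- `TSP(n)` lies in the hyperplane `Σ_e x_e = n` (a convex set, Mathlib's `convex_hyperplane`).
[folklore] -/
theorem tspPolytope_subset_sumEq (n : ℕ) : tspPolytope n ⊆ {x : Edges n → ℝ | ∑ e, x e = n} := by
  refine convexHull_min ?_ (convex_hyperplane
    ⟨fun x y => Finset.sum_add_distrib, fun a x => by simp [Finset.mul_sum]⟩ (n : ℝ))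
  rintro _ ⟨F, hF, rfl⟩
  exact hF.sum_charVec

/-- Appending one equation `a · x = b` to a slack-form system keeps the number of inequalities
and cuts the projection with the hyperplane `{x | a · x = b}`. [folklore] -/
theorem projSet_consRow (k : ℕ) (E : Matrix (Fin k) (Edges n) ℝ) (F : Matrix (Fin k) (Fin r) ℝ)
    (g : Fin k → ℝ) (a : Edges n → ℝ) (b : ℝ) :
    (⟨k + 1, of (vecCons a E), of (vecCons 0 F), vecCons b g⟩ :
        ExtendedFormulation (Edges n) r).projSet =
      (⟨k, E, F, g⟩ : ExtendedFormulation (Edges n) r).projSet ∩ {x | a ⬝ᵥ x = b} := by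
  ext x
  simp only [ExtendedFormulation.projSet, Set.mem_setOf_eq, Set.mem_inter_iff]
  have key : ∀ y : Fin r → ℝ,
      of (vecCons a E) *ᵥ x + of (vecCons (0 : Fin r → ℝ) F) *ᵥ y = vecCons b g ↔
        E *ᵥ x + F *ᵥ y = g ∧ a ⬝ᵥ x = b := by
    intro y
    rw [Matrix.cons_mulVec, Matrix.cons_mulVec, Matrix.cons_add_cons, zero_dotProduct, add_zero]
    change Fin.cons _ _ = Fin.cons _ _ ↔ _
    rw [Fin.cons_inj]
    exact ⟨fun h => ⟨h.2, h.1⟩, fun h => ⟨h.2, h.1⟩⟩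
  constructor
  · rintro ⟨y, hy, hE⟩
    obtain ⟨h1, h2⟩ := (key y).1 hE
    exact ⟨⟨y, hy, h1⟩, h2⟩
  · rintro ⟨⟨y, hy, hE⟩, h2⟩
    exact ⟨y, hy, (key y).2 ⟨hE, h2⟩⟩

/-- `TSP(n)` is closed (the convex hull of finitely many points is compact). [folklore] -/
theorem isClosed_tspPolytope (n : ℕ) : IsClosed (tspPolytope n) := by
  rw [tspPolytope_eq_convexHull_tourVectors]
  exact ((tourVectors n).finite_toSet.isCompact_convexHull (𝕜 := ℝ)).isClosed

/-- **An LP that solves the TSP on all nonnegative weights IS an extended formulation of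
`TSP(n)`, of the same size.** Append the equation `Σ_e x_e = n` (valid for all tours); if a
feasible `x` on that hyperplane were outside `TSP(n)`, a separating functional `c` (geometric
Hahn–Banach against the compact convex `TSP(n)`), shifted by a multiple of the all-ones vector to
make it nonnegative (the shift is constant on the hyperplane), would be a nonnegative instance on
which no tour matches `x` — contradicting exactness. So FMPTW's "LP that solves the TSP" (all
weights, §1.1) and "EF of `TSP(n)`" are the same class, already for nonnegative weights.
[cite: FioriniEtAl2015, §1.1 (PDF p. 3)] -/
theorem LPSolvesTSPOn.hasEFOfSize (h : LPSolvesTSPOn n (nonnegWeights n) r) :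
    HasEFOfSize (tspPolytope n) r := by
  classical
  obtain ⟨⟨k, E, F, g⟩, hsub, hexact⟩ := h
  refine ⟨⟨k + 1, of (vecCons (fun _ => (1 : ℝ)) E), of (vecCons 0 F), vecCons (n : ℝ) g⟩, ?_⟩
  rw [projSet_consRow]
  have hplane : {x : Edges n → ℝ | (fun _ => (1 : ℝ)) ⬝ᵥ x = n} =
      {x : Edges n → ℝ | ∑ e, x e = (n : ℝ)} := by
    ext x
    simp [dotProduct]
  rw [hplane]
  refine Set.Subset.antisymm ?_ fun x hx => ⟨hsub hx, tspPolytope_subset_sumEq n hx⟩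
  rintro x ⟨hxQ, hxsum⟩
  by_contra hxT
  obtain ⟨f, u, hfx, hfT⟩ :=
    geometric_hahn_banach_point_closed (convex_convexHull ℝ _) (isClosed_tspPolytope n) hxT
  -- the weight vector of `f`
  set c : Edges n → ℝ := fun e => f (fun j => if e = j then 1 else 0) with hc
  have hf : ∀ v : Edges n → ℝ, f v = c ⬝ᵥ v := by
    intro v
    have := LinearMap.pi_apply_eq_sum_univ (f : (Edges n → ℝ) →ₗ[ℝ] ℝ) v
    rw [ContinuousLinearMap.coe_coe] at this
    rw [this, dotProduct]
    refine Finset.sum_congr rfl fun e _ => ?_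
    simp [hc, mul_comm]
  -- shift to a nonnegative weight vector
  set lam : ℝ := ∑ e, |c e| with hlam
  set c' : Edges n → ℝ := fun e => c e + lam with hc'
  have hc'W : c' ∈ nonnegWeights n := by
    intro e
    have h1 : |c e| ≤ lam := Finset.single_le_sum (fun i _ => abs_nonneg (c i)) (Finset.mem_univ e)
    have h2 := neg_abs_le (c e)
    simp only [hc']
    linarith
  have key : ∀ v : Edges n → ℝ, c' ⬝ᵥ v = c ⬝ᵥ v + lam * ∑ e, v e := by
    intro v
    simp only [hc', dotProduct, add_mul, Finset.sum_add_distrib, Finset.mul_sum]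
  obtain ⟨F, hF, hle⟩ := hexact c' hc'W x hxQ
  have h1 := hfT _ (charVec_mem_tspPolytope hF)
  rw [hf] at hfx h1
  rw [key, key, hF.sum_charVec] at hle
  have hxsum' : ∑ e, x e = (n : ℝ) := hxsum
  rw [hxsum'] at hle
  linarith

/-- **FMPTW's "LP that solves the TSP" = extended formulation of `TSP(n)`**, size for size.
[cite: FioriniEtAl2015, §1.1 (PDF p. 3)] -/
theorem lpSolvesTSPOn_nonneg_iff : LPSolvesTSPOn n (nonnegWeights n) r ↔ HasEFOfSize (tspPolytope n) r :=
  ⟨LPSolvesTSPOn.hasEFOfSize, fun h => h.lpSolvesTSPOn _⟩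

/-- Monotonicity in the size for the class of nonnegative weights (unused slack columns, via
`HasEFOfSize.of_le`). [folklore] -/
theorem LPSolvesTSPOn.nonneg_of_le {r' : ℕ} (h : LPSolvesTSPOn n (nonnegWeights n) r)
    (hle : r ≤ r') : LPSolvesTSPOn n (nonnegWeights n) r' :=
  (h.hasEFOfSize.of_le hle).lpSolvesTSPOn _

/-! ### The barrier restated on its technique class -/

/-- **The extension-complexity barrier on its exact technique class** (audit form of
`TSPExtensionComplexity`): there is `c > 0` such that for all large `n`, every slack-form LP over
the `(n choose 2)` edge variables of `K_n` plus extra variables that contains the tours and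
returns the optimal tour length for every NONNEGATIVE weight vector has at least `2^{c√n}`
inequalities. Equivalent to `TSPExtensionComplexity` (`tspExtensionComplexityNarrow_iff`).

BARRIER
technique_class: extended-formulations, extension-complexity, exact-lp-optimizer-for-tsp (uniform in `n`, natural edge variables or any linear encoding with affine objective read-out, all / all nonnegative / `{0,1,2}` weights), symmetric-lp, sdp-extended-formulations, mixed-integer-ef-with-few-integer-variables
blocks: proofs of `P = NP` (the NEGATION of `PneNP`; the routes' staffed `¬X` items) that exhibit, for each `n`, ONE polynomial-size linear (or semidefinite, or mixed-integer with `o(n / log n)` integer variables) program whose feasible region contains (an encoding of) every tour of `K_n` and over which linear optimisation returns the optimal tour value for every instance of a weight class at least as rich as `{0,1,2}`-weights — Swart 1986/87 (`n^8`, `n^{10}` LPs), Diaby et al. 2006–2016 [cite: Yannakakis1991, p. 442] [cite: Diaby2016, abstract (PDF p. 1)]; formally `LPSolvesTSPOn n (nonnegWeights n) (poly n)` is refuted eventually in `n` (`TSPExtensionComplexity.no_polysize_lp_solves`), being the same as `HasEFOfSize (tspPolytope n) (poly n)` (`lpSolvesTSPOn_nonneg_iff`) [cite: FioriniEtAl2015,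 §1.1 (PDF p. 3) and Thm. 12 (PDF p. 11)].
because: an LP exact on all nonnegative weights, cut with `Σ_e x_e = n`, projects exactly onto `TSP(n)` (separation; `LPSolvesTSPOn.hasEFOfSize`), and `xc(TSP(n)) ≥ 2^{Ω(√n)}` [cite: FioriniEtAl2015, Thm. 12 (PDF p. 11)], indeed `2^{Ω(n)}` through Yannakakis' face `TSP(6n) → PM(2n)` [cite: Rothvoss2017, Cor. 2 (PDF p. 4)] [cite: Yannakakis1991, Thm. 2 (p. 454)]; for `{0,1,2}` weights and arbitrary linear encodings: LP formulation complexity of maximum-weight Hamiltonian cycle is `2^{Ω(n)}` by an affine reduction from matching [cite: BraunPokuttaZink2015, Def. 2.5 (PDF pp. 6–7) and Example 4.7 (PDF pp. 15–16)]; SDP: `psdrank(TSP(n)) ≥ 2^{Ω(n^{1/13})}` [cite: LeeRaghavendraSteurer2015, Cor. 1.2 (PDF p. 4)]; MILEF: size `≤ 2^{γn}` forces `Ω(n / log n)` integer variables [cite: CevallosWeltgeZenklusen2018, Cor. 25 (PDF p. 16)].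
evasions_known: NONE of the following evade — re-encoding in non-natural variables with linear cost read-out (claimed in [cite: Diaby2016, App. A (PDF p. 14)]; void by encoding-independence [cite: BraunPokuttaZink2015, §3.1.1 (PDF p. 11)], and the LPs fail on explicit instances [cite: Hofman2006, abstract] [cite: Hofman2025, abstract]); restricting to `{0,1,2}`-weights / Hamiltonicity-by-optimisation [cite: BraunPokuttaZink2015, Example 4.7]; SDPs [cite: LeeRaghavendraSteurer2015, Cor. 1.2]. GENUINELY outside (and provably not closable short of `NP ⊄ P/poly`): Yannakakis' HC polytopes — an LP over the edge variables `z` whose projection merely CONTAINS the characteristic vectors of the Hamiltonian graphs and EXCLUDES those of the non-Hamiltonian ones exists in polynomial size for all `n` iff `NP ⊆ P/poly` ("the P = NP? question is equivalent to a weaker requirement of the LP than that expressing the TSP polytope"; `IsHCPolytope`; circuit ⇒ HC polytope of size `5·(circuit size)` is the theorem `hasHCPolytopeOfSize_of_circuit` of the companion file) [cite: Yannakakis1991, Proposition (p. 445)]; likewise instance-dependent LPs (the graph in the constraints) and LP as a subroutine (branch-and-cut, cutting planes) are algorithms, outside every EF theorem [cite: Yannakakis1991, p. 442]; small `xc` is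 not necessary for polynomial time (perfect matching) [cite: Rothvoss2017, Thm. 1 (PDF p. 4)].
scope_caveats: supersedes the `technique_class`/`evasions_known` prose of `TSPExtensionComplexity` (whose formal statement is unchanged and equivalent to this one): the tags `polynomial-size-lp`, `lp-for-tsp`, `compact-lp-formulations` there are too broad — only OPTIMIZING LPs uniform in `n` are barred, decision LPs (HC polytopes) are not; and its "NOT covered: semidefinite EFs / LPs correct only on some objective functions / different encodings" is too generous — those are barred in print (above). Pure `0/1` weights (`zeroOneWeights`, Hamiltonicity of subgraphs of `K_n`): DERIVED, NOT PRINTED (the printed Example 4.7 uses weights `{0,1,2}`) — the same `2^{Ω(n)}` follows by combining three printed ingredients: on Yannakakis' `6n`-node graph `G` (tours of `G` = perfect matchings of `K_L`) [cite: Yannakakis1991, Thm. 2 (p. 454)] the `0/1` weight `𝟙_{δ_L(U)} + 𝟙_{E ∖ E(G)}` (`U ⊆ L` odd) has optimum `1` and slack `|M ∩ δ(U)| - 1` on the matching tours, i.e. Rothvoß's odd-set slack block, of nonnegative rank `2^{Ω(n)}` [cite: Rothvoss2017, Thm. 1 and the odd-set slack matrix (PDF pp. 4–5)], and an LP formulation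 exact on these instances factors that block (LP duality, as in the pair / optimisation-problem factorisation theorems) [cite: BraunPokuttaZink2015, Def. 2.5 (PDF pp. 6–7)] [cite: FioriniEtAl2015, §6 (PDF p. 16)]. Sizes ignore coefficient bit-length (lower bounds only get stronger). `n ≤ 2`: no tours, every statement vacuous-but-harmless under "eventually".
status: established [cite: FioriniEtAl2015, Thm. 12] [cite: Rothvoss2017, Cor. 2] [cite: BraunPokuttaZink2015, Example 4.7] [cite: LeeRaghavendraSteurer2015, Cor. 1.2] -/
def TSPExtensionComplexityNarrow : Prop :=
  ∃ c : ℝ, 0 < c ∧ ∀ᶠ n : ℕ in atTop, ∀ r : ℕ, LPSolvesTSPOn n (nonnegWeights n) r →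
    (2 : ℝ) ^ (c * Real.sqrt n) ≤ r

/-- The audit form is equivalent to the catalogued fact. [cite: FioriniEtAl2015, §1.1 (PDF p. 3) and Thm. 12 (PDF p. 11)] -/
theorem tspExtensionComplexityNarrow_iff : TSPExtensionComplexityNarrow ↔ TSPExtensionComplexity := by
  simp only [TSPExtensionComplexityNarrow, TSPExtensionComplexity, lpSolvesTSPOn_nonneg_iff]

/-- **No polynomial-size LP solves the TSP** (FMPTW's headline in their own sense of "solves",
§1.1): for every exponent `K`, for all large `n`, no slack-form LP over the edge variables of
`K_n` with at most `n^K + K` inequalities contains the tours and optimises every nonnegative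
instance exactly. [cite: FioriniEtAl2015, §1 (PDF p. 3) and Thm. 12 (PDF p. 11)] -/
theorem TSPExtensionComplexity.no_polysize_lp_solves (h : TSPExtensionComplexity) (K : ℕ) :
    ∀ᶠ n : ℕ in atTop, ∀ r ≤ n ^ K + K, ¬ LPSolvesTSPOn n (nonnegWeights n) r := by
  filter_upwards [h.not_poly K] with n hn r hr hLP
  exact hn (hLP.nonneg_of_le hr).hasEFOfSize

/-! ### Yannakakis' HC polytopes: the decision format the barrier does not touch -/

/-- The `0/1` point of `ℝ^{E_n}` with support `z` (the characteristic vector of the graph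
`{e | z e}`). [cite: Yannakakis1991, p. 445] -/
def boolVec (z : Edges n → Bool) : Edges n → ℝ := fun e => if z e then 1 else 0

/-- The graph with edge set `{e | z e}` is Hamiltonian: it contains the edge set of a tour of
`K_n` (the file's `IsTourEdgeSet`). This is Mathlib's `SimpleGraph.IsHamiltonian` for
`SimpleGraph.fromEdgeSet {e | z e}` EXCEPT at `n = 1`, where Mathlib's convention
(`Fintype.card α ≠ 1 → …`) counts `K_1` as Hamiltonian while here `Edges 1` is empty and no `z` is;
irrelevant for the asymptotic statements. [cite: Yannakakis1991, p. 445 ("characteristic vectors of Hamiltonian graphs")] -/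
def IsHamiltonianSupport (z : Edges n → Bool) : Prop :=
  ∃ F : Finset (Sym2 (Fin n)), IsTourEdgeSet F ∧ ∀ e : Edges n, (e : Sym2 (Fin n)) ∈ F → z e = true

/-- **Yannakakis' Hamilton-circuit (HC) polytopes**: "a polytope `Q` in variables `z_ij` is a
Hamilton circuit (HC) polytope if it includes the characteristic vectors of Hamiltonian graphs
and excludes non-Hamiltonian (considered again as subsets of the edges of the complete graph)".
Only membership of the `2^{|E_n|}` integral points is constrained. [cite: Yannakakis1991, p. 445] -/
def IsHCPolytope (n : ℕ) (Q : Set (Edges n → ℝ)) : Prop :=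
  ∀ z : Edges n → Bool, boolVec z ∈ Q ↔ IsHamiltonianSupport z

/-- Some slack-form LP with `r` inequalities over the edge variables of `K_n` (plus extra
variables) "expresses an HC polytope": its projection is one. [cite: Yannakakis1991, p. 445] -/
def HasHCPolytopeOfSize (n r : ℕ) : Prop :=
  ∃ Q : ExtendedFormulation (Edges n) r, IsHCPolytope n Q.projSet

/-- The extra-variable block of the upward closure: columns `F` for `y` followed by columns `-E`
for the slacks `s` (indexed through `Fintype.equivFin`). [folklore] -/
def upClosureF {k : ℕ} (E : Matrix (Fin k) (Edges n) ℝ) (F : Matrix (Fin k) (Fin r) ℝ) :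
    Matrix (Fin k) (Fin (r + Fintype.card (Edges n))) ℝ :=
  Matrix.of fun i j => Fin.addCases (fun j₁ => F i j₁)
    (fun j₂ => -(E i ((Fintype.equivFin (Edges n)).symm j₂))) j

/-- The block `[F | -E]` acts as `F y - E s`. [folklore] -/
theorem upClosureF_mulVec {k : ℕ} (E : Matrix (Fin k) (Edges n) ℝ) (F : Matrix (Fin k) (Fin r) ℝ)
    (y : Fin r → ℝ) (s : Edges n → ℝ) :
    upClosureF E F *ᵥ Fin.append y (fun j₂ => s ((Fintype.equivFin (Edges n)).symm j₂)) =
      F *ᵥ y - E *ᵥ s := by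
  funext i
  simp only [mulVec, dotProduct, Pi.sub_apply]
  rw [Fin.sum_univ_add]
  simp only [upClosureF, Matrix.of_apply, Fin.addCases_left, Fin.addCases_right, Fin.append_left,
    Fin.append_right]
  rw [sub_eq_add_neg, ← Finset.sum_neg_distrib]
  congr 1
  rw [← Equiv.sum_comp (Fintype.equivFin (Edges n)).symm]
  refine Finset.sum_congr rfl fun j _ => ?_
  ring

/-- **Upward closure in the natural variables**: from `Q = {x | ∃ y ≥ 0, E x + F y = g}` with
`r` inequalities, the system `E z + [F | -E] (y, s) = g`, `(y, s) ≥ 0` with `r + |E_n|`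
inequalities projects onto `{z | ∃ x ∈ Q, x ≤ z}` (substitute `x = z - s`). [folklore] -/
theorem projSet_upClosure (k : ℕ) (E : Matrix (Fin k) (Edges n) ℝ) (F : Matrix (Fin k) (Fin r) ℝ)
    (g : Fin k → ℝ) :
    (⟨k, E, upClosureF E F, g⟩ : ExtendedFormulation (Edges n) (r + Fintype.card (Edges n))).projSet =
      {z | ∃ x ∈ (⟨k, E, F, g⟩ : ExtendedFormulation (Edges n) r).projSet, ∀ e, x e ≤ z e} := by
  classical
  set eqv := Fintype.equivFin (Edges n) with heqv
  ext z
  simp only [ExtendedFormulation.projSet, Set.mem_setOf_eq]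
  constructor
  · rintro ⟨w, hw, hE⟩
    set y : Fin r → ℝ := fun j₁ => w (Fin.castAdd _ j₁) with hy
    set s : Edges n → ℝ := fun e => w (Fin.natAdd r (eqv e)) with hs
    have hws : w = Fin.append y (fun j₂ => s (eqv.symm j₂)) := by
      conv_lhs => rw [← Fin.append_castAdd_natAdd (f := w)]
      congr 1
      funext j₂
      simp [hs]
    rw [hws, upClosureF_mulVec E F y s] at hE
    refine ⟨z - s, ⟨y, fun j => hw _, ?_⟩, fun e => ?_⟩
    · rw [mulVec_sub, ← hE]
      abel
    · have : 0 ≤ s e := hw _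
      simp only [Pi.sub_apply]
      linarith
  · rintro ⟨x, ⟨y, hy, hE⟩, hle⟩
    refine ⟨Fin.append y (fun j₂ => (z - x) (eqv.symm j₂)), fun j => ?_, ?_⟩
    · refine Fin.addCases (fun j₁ => ?_) (fun j₂ => ?_) j
      · simpa using hy j₁
      · have := hle (eqv.symm j₂)
        simp only [Fin.append_right, Pi.sub_apply]
        linarith
    · rw [upClosureF_mulVec E F y (z - x), ← hE, mulVec_sub]
      abel

/-- **An LP solving the TSP on `0/1` weights expresses an HC polytope** (Yannakakis: "if an LP
expresses the TSP polytope in variables `x_ij`, then the polytope obtained by adding constraints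
`x_ij ≤ z_ij` and then projecting the feasible space on `z` is a HC polytope"; exactness on `0/1`
weights is all that is used): `z ⊇` a tour gives feasibility through that tour; conversely a
feasible `x ≤ χ^H` has `Σ_{e ∉ H} x_e ≤ 0`, so the matching tour for the `0/1` weight `𝟙_{E ∖ H}`
lies inside `H`. Size `r + |E_n|`. [cite: Yannakakis1991, p. 445] -/
theorem LPSolvesTSPOn.hasHCPolytopeOfSize (h : LPSolvesTSPOn n (zeroOneWeights n) r) :
    HasHCPolytopeOfSize n (r + Fintype.card (Edges n)) := by
  classical
  obtain ⟨⟨k, E, F, g⟩, hsub, hexact⟩ := h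
  refine ⟨⟨k, E, upClosureF E F, g⟩, fun z => ?_⟩
  rw [projSet_upClosure]
  simp only [Set.mem_setOf_eq]
  constructor
  · rintro ⟨x, hxQ, hle⟩
    -- the 0/1 weight of the non-edges of the graph `z`
    set c : Edges n → ℝ := fun e => if z e then 0 else 1 with hc
    have hcW : c ∈ zeroOneWeights n := fun e => by by_cases hz : z e <;> simp [hc, hz]
    obtain ⟨F, hF, hFle⟩ := hexact c hcW x hxQ
    have hcx : c ⬝ᵥ x ≤ 0 := by
      have : c ⬝ᵥ x ≤ c ⬝ᵥ boolVec z := by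
        simp only [dotProduct]
        exact Finset.sum_le_sum fun e _ => mul_le_mul_of_nonneg_left (hle e)
          (by by_cases hz : z e <;> simp [hc, hz])
      have h0 : c ⬝ᵥ boolVec z = 0 := by
        simp only [dotProduct]
        refine Finset.sum_eq_zero fun e _ => ?_
        by_cases hz : z e <;> simp [hc, boolVec, hz]
      linarith
    have hterm : ∀ e, 0 ≤ c e * charVec F e := fun e => by
      by_cases hz : z e <;> by_cases he : (e : Sym2 (Fin n)) ∈ F <;> simp [hc, charVec, hz, he]
    have hsum0 : c ⬝ᵥ charVec F = 0 :=
      le_antisymm (hFle.trans hcx) (Finset.sum_nonneg fun e _ => hterm e)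
    have heach : ∀ e, c e * charVec F e = 0 := fun e =>
      (Finset.sum_eq_zero_iff_of_nonneg fun e _ => hterm e).1 hsum0 e (Finset.mem_univ e)
    refine ⟨F, hF, fun e he => ?_⟩
    by_contra hz
    have := heach e
    simp [hc, charVec, hz, he] at this
  · rintro ⟨F, hF, hFz⟩
    refine ⟨charVec F, hsub (charVec_mem_tspPolytope hF), fun e => ?_⟩
    by_cases he : (e : Sym2 (Fin n)) ∈ F
    · simp [charVec, boolVec, he, hFz e he]
    · by_cases hz : z e <;> simp [charVec, boolVec, he, hz]

/-- In particular an extended formulation of `TSP(n)` of size `r` gives an HC polytope of size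
`r + |E_n|` (Yannakakis' example). [cite: Yannakakis1991, p. 445] -/
theorem HasEFOfSize.hasHCPolytopeOfSize (h : HasEFOfSize (tspPolytope n) r) :
    HasHCPolytopeOfSize n (r + Fintype.card (Edges n)) :=
  (h.lpSolvesTSPOn (zeroOneWeights n)).hasHCPolytopeOfSize

/-- HAMILTONIAN CYCLE on `K_n`-subgraphs as a Boolean function of the edge indicators (the input
convention of Yannakakis' Proposition: "a circuit for the Hamilton circuit problem with inputs
`z_ij`"). [cite: Yannakakis1991, p. 445] -/
def hamiltonianFn (n : ℕ) : (Edges n → Bool) → Bool :=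
  fun z => @decide (IsHamiltonianSupport z) (Classical.dec _)

/-!
### Yannakakis' Proposition

"NP has polynomial size circuits (resp. P = NP) if and only if (for every `n`) there is a
polynomial size LP (resp., that can be constructed efficiently) which expresses a HC polytope"
(Yannakakis 1991, Proposition, p. 445; the `→` half is Valiant's gate-by-gate LP: `0 ≤ g = 1 - u
≤ 1` for `¬`, `0 ≤ g ≤ u ≤ 1, 0 ≤ g ≤ v ≤ 1, g ≥ u + v - 1` for `∧`, `0 ≤ u ≤ g ≤ 1, 0 ≤ v ≤ g
≤ 1, g ≤ u + v` for `∨`, and `g_out = 1`). Its `→` half at a fixed input length — a De Morgan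
circuit of size `s` for HAMILTONIAN CYCLE on the edge indicators of `K_n` yields an HC polytope
expressed by a slack-form LP with `5 s` inequalities — is PROVED (not assumed) in the companion
file `TSPExtensionComplexityHCPolytopeCircuit.lean` (`hasHCPolytopeOfSize_of_circuit`), from
the generic circuit LP of `TSPExtensionComplexityCircuitLP.lean`. Consequence for the catalogue:
a super-polynomial lower bound on `HasHCPolytopeOfSize n ·` is a De Morgan circuit lower bound
for HAMILTONIAN CYCLE (`NP ⊄ P/poly`); no extension-complexity theorem reaches HC polytopes.
-/

end Literature.Barriers.PneNP

end
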